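import Literature.AlgebraicGeometry.HodgeTheory.FermatHodgeCharacters
import HarnessLib

/-!
# The character criterion for Hodge characters of Fermat varieties (Aoki 1983, Prop. 2.1–2.2; Kubert–Lang ST1–ST4)

Support file (everything PROVED; no named facts, no definitions) for the structure theorem of
the Hodge characters of the Fermat surface (`AokiShioda1983_thmB2m_standard`, file
`FermatSurfaceHodgeCharacterStructure`): the NECESSARY direction of Aoki's character criterion
[Aoki1983, Prop. 2.2] "`α ∈ Bₘ ⇔ τ_d(α) ∈ A(m/d)` for all `d ∣ m`", in the following explicit form.

For a Dirichlet character `ψ` mod `m` put `L_ψ(x) = ∑_{u mod m} ψ(u) β(ux)` (`β(y) = ⟨y⟩/m - 1/2`,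
`β(0) = 0`, the Bernoulli distribution of `KoblitzOgus`). Then:

* `IsHodge.sum_sum_char_mul_bern_eq_zero`: for a Hodge character `α = (α₀, …, α_{r-1})` of level `m`
  and EVERY `ψ`, `∑ᵢ L_ψ(αᵢ) = 0` (the Hodge condition `∑ᵢ β(uαᵢ) = |uα| - r/2 = 0` summed against `ψ`).
* `sum_char_mul_bern_lift_of_changeLevel` / `…_of_not_factorsThrough` (= [Aoki1983, Prop. 2.1],
  [KubertLang1981, Ch. 1 §3 ST1–ST4]): at a point `x = (m/M)·w` of exact level `M ∣ m` (`w` a unit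
  mod `M`), `L_ψ(x) = (φ(m)/φ(M)) · ψ_M(w)⁻¹ · B₁(ψ_M)` if `ψ = ψ_M ∘ (mod M)` factors through `M`,
  where `B₁(ψ_M) = ∑_{s mod M} ψ_M(s) β_M(s)` is the (imprimitive) first Bernoulli number of `ψ_M`,
  and `L_ψ(x) = 0` if `ψ` does not factor through `M`.
* `bernoulliSum_changeLevel` (Euler factors): `B₁(χ ∘ (mod f)) = ∏_{p ∣ M} (1 - χ(p)) · B₁(χ)` for
  `χ` mod `f ∣ M`, and `bernoulliSum_ne_zero`: `B₁(χ) ≠ 0` for `χ` odd primitive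
  (`KoblitzOgus.sum_char_mul_val_ne_zero`, i.e. `L(0, χ) ≠ 0`, [Aoki1983, Lemma 2.3]).
* `IsHodge.aoki_criterion`: the resulting master relation — for every `f ∣ m` and every odd
  primitive `χ` mod `f`, `∑_{i : f ∣ Mᵢ} (φ(m)/φ(Mᵢ)) ∏_{p ∣ Mᵢ} (1 - χ(p)) · χ(wᵢ)⁻¹ = 0`, where
  `αᵢ = (m/Mᵢ)·wᵢ` — Aoki's "`χ(τ_{m/f}(α)) = 0` for `χ ∈ PC⁻(f)`".

Only this direction of Prop. 2.2 is used in the proof of Theorem C (loc. cit. §9); the converse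
(sufficiency) is not formalised here.

## References

* [Aoki1983] N. Aoki, On some arithmetic problems related to the Hodge cycles on the Fermat
  varieties, Math. Ann. 266 (1983) 23–54, §2 (Prop. 2.1, Prop. 2.2, Lemma 2.3) (text read, GDZ scan).
* [KubertLang1981] D. Kubert, S. Lang, Modular Units, Grundlehren 244, Springer 1981, Ch. 1 §3.
* [Lang1990] S. Lang, Cyclotomic Fields I and II, GTM 121, Ch. 2 §2 (Bernoulli distribution).
-/

noncomputable section

open Finset

namespace Literature.AlgebraicGeometry.HodgeTheory

namespace FermatCharacter

open Literature.NumberTheory.Transcendental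

variable {m : ℕ}

/-! ### The Hodge condition summed against a Dirichlet character -/

/-- For a Hodge character `α` and a unit `u`: `∑ᵢ β(uαᵢ) = |uα| - r/2 = 0`.
[cite: Shioda1979PJA, §1 eq. (2)] -/
theorem IsHodge.sum_bern_eq_zero [NeZero m] {r : ℕ} {α : Fin r → ZMod m} (h : IsHodge α)
    {u : ZMod m} (hu : IsUnit u) :
    ∑ i, (if (u * α i) = (0 : ZMod m) then (0 : ℂ) else (((ZMod.val (u * α i) : ℕ) : ℂ) / (m : ℂ) - 1 / 2)) = 0 := by
  obtain ⟨t, rfl⟩ := hu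
  have hne : ∀ i, (t : ZMod m) * α i ≠ 0 := fun i ↦ (Units.mul_right_eq_zero t).not.mpr (h.1.1 i)
  simp_rw [if_neg (hne _)]
  rw [Finset.sum_sub_distrib, Finset.sum_const, Finset.card_univ, Fintype.card_fin, nsmul_eq_mul,
    ← Finset.sum_div]
  have h2 := h.2 t
  unfold normSum at h2
  have hm0 : (m : ℂ) ≠ 0 := by exact_mod_cast NeZero.ne m
  have h2' : (∑ i, ((((t : ZMod m) * α i).val : ℕ) : ℂ)) = (m : ℂ) * r / 2 := by
    have := congrArg (Nat.cast (R := ℂ)) h2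
    push_cast at this
    linear_combination this / 2
  rw [h2']
  field_simp
  ring

/-- **The Hodge condition summed against a character**: for a Hodge character `α` of level `m` and
ANY Dirichlet character `ψ` mod `m`, `∑ᵢ ∑_u ψ(u) β(uαᵢ) = 0` (non-units contribute `ψ(u) = 0`).
[cite: Aoki1983, §1 Prop. 1.3 and §2 Prop. 2.2] -/
theorem IsHodge.sum_sum_char_mul_bern_eq_zero [NeZero m] {r : ℕ} {α : Fin r → ZMod m}
    (h : IsHodge α) (ψ : DirichletCharacter ℂ m) :
    ∑ i, ∑ u : ZMod m, ψ u *
      (if (u * α i) = (0 : ZMod m) then (0 : ℂ) else (((ZMod.val (u * α i) : ℕ) : ℂ) / (m : ℂ) - 1 / 2)) = 0 := by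
  rw [Finset.sum_comm]
  refine Finset.sum_eq_zero fun u _ ↦ ?_
  rw [← Finset.mul_sum]
  by_cases hu : IsUnit u
  · rw [h.sum_bern_eq_zero hu, mul_zero]
  · rw [MulChar.map_nonunit ψ hu, zero_mul]

/-! ### Points of level `M`: `x = (m/M)·w` -/

/-- The value of `β_m` at the lift `(m/M)·v` of `v ∈ ℤ/M` is `β_M(v)`. [folklore] -/
theorem bern_lift [NeZero m] {M : ℕ} (hM : M ∣ m) (v : ZMod M) :
    (if ((((m / M : ℕ) : ZMod m) * ((ZMod.val v : ℕ) : ZMod m))) = (0 : ZMod m) then (0 : ℂ)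
      else (((ZMod.val ((((m / M : ℕ) : ZMod m) * ((ZMod.val v : ℕ) : ZMod m))) : ℕ) : ℂ) / (m : ℂ) - 1 / 2)) =
    (if v = 0 then 0 else ((v.val : ℂ) / M - 1 / 2)) := by
  obtain ⟨hM0, hm0, hmM⟩ := KoblitzOgus.div_ne_zero_of_dvd hM
  haveI : NeZero M := ⟨hM0⟩
  have hvv : (((v.val : ℕ) : ZMod m)).val = v.val :=
    ZMod.val_natCast_of_lt ((ZMod.val_lt v).trans_le (Nat.le_of_dvd (NeZero.pos m) hM))
  have h1 : ((((m / M : ℕ) : ZMod m) * ((ZMod.val v : ℕ) : ZMod m))).val = m / M * v.val := by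
    rw [KoblitzOgus.val_div_mul hM, hvv, Nat.mod_eq_of_lt (ZMod.val_lt v)]
  by_cases hv0 : v = 0
  · simp [hv0]
  · have hne : (((m / M : ℕ) : ZMod m) * ((ZMod.val v : ℕ) : ZMod m)) ≠ 0 := by
      rw [Ne, ← ZMod.val_eq_zero, h1]
      exact Nat.mul_ne_zero hm0 ((ZMod.val_ne_zero v).mpr hv0)
    rw [if_neg hne, if_neg hv0, h1]
    have : (m : ℂ) = M * (m / M : ℕ) := by exact_mod_cast hmM
    rw [this]
    have hMC : (M : ℂ) ≠ 0 := by exact_mod_cast hM0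
    have hqC : ((m / M : ℕ) : ℂ) ≠ 0 := by exact_mod_cast hm0
    push_cast
    field_simp

/-- `(m/M)·a = (m/M)·b` in `ℤ/m` as soon as `a ≡ b (mod M)`. [folklore] -/
theorem div_mul_eq_of_cast_eq [NeZero m] {M : ℕ} (hM : M ∣ m) {a b : ZMod m}
    (h : ZMod.castHom hM (ZMod M) a = ZMod.castHom hM (ZMod M) b) :
    ((m / M : ℕ) : ZMod m) * a = ((m / M : ℕ) : ZMod m) * b := by
  apply ZMod.val_injective
  rw [KoblitzOgus.val_div_mul hM, KoblitzOgus.val_div_mul hM,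
    (KoblitzOgus.mod_eq_mod_iff_castHom hM a b).mpr h]

/-- Multiplying the lift of `w` by `u` gives the lift of `ū w` (`ū = u mod M`). [folklore] -/
theorem mul_lift_eq [NeZero m] {M : ℕ} (hM : M ∣ m) (u : ZMod m) (w : ZMod M) :
    u * (((m / M : ℕ) : ZMod m) * ((ZMod.val w : ℕ) : ZMod m)) =
      ((m / M : ℕ) : ZMod m) * ((ZMod.val (ZMod.castHom hM (ZMod M) u * w) : ℕ) : ZMod m) := by
  obtain ⟨hM0, -, -⟩ := KoblitzOgus.div_ne_zero_of_dvd hM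
  haveI : NeZero M := ⟨hM0⟩
  rw [mul_left_comm]
  apply div_mul_eq_of_cast_eq hM
  rw [map_mul, map_natCast, map_natCast, ZMod.natCast_zmod_val, ZMod.natCast_zmod_val]

/-! ### Fibre sums of a character over the reduction `ℤ/m → ℤ/M` -/

/-- The number of units of `ℤ/m` is `φ(m)`, counted inside `ZMod m`. [folklore] -/
theorem card_filter_isUnit [NeZero m] : #{u : ZMod m | IsUnit u} = m.totient := by
  classical
  rw [← ZMod.card_units_eq_totient, ← Fintype.card_subtype]
  refine Fintype.card_congr ?_
  exact
    { toFun := fun u ↦ u.2.unit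
      invFun := fun t ↦ ⟨t, Units.isUnit t⟩
      left_inv := fun u ↦ by ext; simp
      right_inv := fun t ↦ by ext; simp }

/-- **Uniform fibres.** For `M ∣ m` and a unit `v` mod `M`, exactly `φ(m)/φ(M)` units of `ℤ/m`
reduce to `v`: `φ(M) · #{u unit | u ≡ v} = φ(m)` (multiplication by a unit lifting `v'/v` is a
bijection between the fibres over `v` and `v'`, and the units of `ℤ/m` are partitioned by the
fibres over the units of `ℤ/M`). [folklore] -/
theorem totient_mul_card_fiber [NeZero m] {M : ℕ} (hM : M ∣ m) {v : ZMod M} (hv : IsUnit v) :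
    M.totient * #{u : ZMod m | IsUnit u ∧ ZMod.castHom hM (ZMod M) u = v} = m.totient := by
  classical
  obtain ⟨hM0, -, -⟩ := KoblitzOgus.div_ne_zero_of_dvd hM
  haveI : NeZero M := ⟨hM0⟩
  -- all fibres over units have the same size
  have hconst : ∀ v' : ZMod M, IsUnit v' →
      #{u : ZMod m | IsUnit u ∧ ZMod.castHom hM (ZMod M) u = v'} =
        #{u : ZMod m | IsUnit u ∧ ZMod.castHom hM (ZMod M) u = v} := by
    intro v' hv'
    -- a unit `t` of `ℤ/m` lifting `v' v⁻¹`
    obtain ⟨t, ht⟩ := ZMod.unitsMap_surjective hM (hv'.unit * hv.unit⁻¹)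
    have htv : ZMod.castHom hM (ZMod M) (t : ZMod m) * v = v' := by
      have := congrArg (fun z : (ZMod M)ˣ ↦ (z : ZMod M)) ht
      simp only [ZMod.unitsMap_def, Units.coe_map, MonoidHom.coe_coe, Units.val_mul,
        IsUnit.unit_spec] at this
      rw [this, mul_assoc, IsUnit.val_inv_mul, mul_one]
    symm
    refine Finset.card_bij (fun u _ ↦ (t : ZMod m) * u) (fun u hu ↦ ?_) (fun u₁ _ u₂ _ h ↦ ?_)
      (fun u' hu' ↦ ?_)
    · simp only [mem_filter, mem_univ, true_and] at hu ⊢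
      refine ⟨(Units.isUnit t).mul hu.1, ?_⟩
      rw [map_mul, hu.2, htv]
    · exact (Units.mul_right_inj t).mp h
    · simp only [mem_filter, mem_univ, true_and] at hu' ⊢
      refine ⟨(t⁻¹ : (ZMod m)ˣ) * u', ⟨(Units.isUnit t⁻¹).mul hu'.1, ?_⟩, by simp⟩
      have h2 : ZMod.castHom hM (ZMod M) (t : ZMod m) *
          ZMod.castHom hM (ZMod M) ((t⁻¹ : (ZMod m)ˣ) : ZMod m) = 1 := by
        rw [← map_mul, Units.mul_inv, map_one]
      have h3 : ZMod.castHom hM (ZMod M) ((t⁻¹ : (ZMod m)ˣ) : ZMod m) * v' = v := by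
        rw [← htv, ← mul_assoc, mul_comm _ (ZMod.castHom hM (ZMod M) (t : ZMod m)), h2, one_mul]
      rw [map_mul, hu'.2, h3]
  -- the units of `ℤ/m` are partitioned by the fibres over the units of `ℤ/M`
  have hmaps : ∀ u ∈ ({u : ZMod m | IsUnit u} : Finset (ZMod m)),
      ZMod.castHom hM (ZMod M) u ∈ ({v' : ZMod M | IsUnit v'} : Finset (ZMod M)) := by
    intro u hu
    simp only [mem_filter, mem_univ, true_and] at hu ⊢
    exact hu.map _
  have hpart := Finset.card_eq_sum_card_fiberwise hmaps
  rw [card_filter_isUnit] at hpart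
  have hfib : ∀ v' ∈ ({v' : ZMod M | IsUnit v'} : Finset (ZMod M)),
      #{u ∈ ({u : ZMod m | IsUnit u} : Finset (ZMod m)) | ZMod.castHom hM (ZMod M) u = v'} =
        #{u : ZMod m | IsUnit u ∧ ZMod.castHom hM (ZMod M) u = v} := by
    intro v' hv'
    simp only [mem_filter, mem_univ, true_and] at hv'
    rw [← hconst v' hv', Finset.filter_filter]
  rw [Finset.sum_congr rfl hfib, Finset.sum_const, card_filter_isUnit, smul_eq_mul] at hpart
  exact hpart.symm


/-- The level change of `ψ₀` evaluated inside `ZMod m`: `ψ₀(u mod M)` on units, `0` otherwise.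
[folklore] -/
theorem changeLevel_apply_eq [NeZero m] {M : ℕ} (hM : M ∣ m) (ψ₀ : DirichletCharacter ℂ M)
    (u : ZMod m) :
    DirichletCharacter.changeLevel hM ψ₀ u =
      if IsUnit u then ψ₀ (ZMod.castHom hM (ZMod M) u) else 0 := by
  split_ifs with hu
  · rw [← hu.unit_spec, DirichletCharacter.changeLevel_eq_cast_of_dvd ψ₀ hM hu.unit,
      ZMod.castHom_apply]
  · exact MulChar.map_nonunit _ hu

/-- **Fibre sum of a character that factors through `M`**: for `ψ = ψ₀ ∘ (mod M)` and `v ∈ ℤ/M`,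
`∑_{u ≡ v (M)} ψ(u) = (φ(m)/φ(M)) ψ₀(v)`. [cite: KubertLang1981, Ch. 1 §3] -/
theorem sum_fiber_changeLevel [NeZero m] {M : ℕ} (hM : M ∣ m) (ψ₀ : DirichletCharacter ℂ M)
    (v : ZMod M) :
    ∑ u : ZMod m, (if ZMod.castHom hM (ZMod M) u = v then
        DirichletCharacter.changeLevel hM ψ₀ u else 0) =
      ((m.totient : ℂ) / (M.totient : ℂ)) * ψ₀ v := by
  classical
  obtain ⟨hM0, -, -⟩ := KoblitzOgus.div_ne_zero_of_dvd hM
  haveI : NeZero M := ⟨hM0⟩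
  have hterm : ∀ u : ZMod m, (if ZMod.castHom hM (ZMod M) u = v then
      DirichletCharacter.changeLevel hM ψ₀ u else 0) =
      if (IsUnit u ∧ ZMod.castHom hM (ZMod M) u = v) then ψ₀ v else 0 := by
    intro u
    rw [changeLevel_apply_eq hM ψ₀ u]
    by_cases h1 : ZMod.castHom hM (ZMod M) u = v
    · by_cases h2 : IsUnit u
      · rw [if_pos h1, if_pos h2, if_pos ⟨h2, h1⟩, h1]
      · rw [if_pos h1, if_neg h2, if_neg (fun h ↦ h2 h.1)]
    · rw [if_neg h1, if_neg (fun h ↦ h1 h.2)]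
  simp_rw [hterm]
  rw [← Finset.sum_filter, Finset.sum_const, nsmul_eq_mul]
  by_cases hv : IsUnit v
  · have hc := totient_mul_card_fiber hM hv
    have hMt : (M.totient : ℂ) ≠ 0 := by exact_mod_cast (Nat.totient_pos.mpr (NeZero.pos M)).ne'
    have : (#{u : ZMod m | IsUnit u ∧ ZMod.castHom hM (ZMod M) u = v} : ℂ) =
        (m.totient : ℂ) / M.totient := by
      rw [eq_div_iff hMt, mul_comm]
      exact_mod_cast hc
    rw [this]
  · rw [MulChar.map_nonunit ψ₀ hv, mul_zero, mul_zero]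

/-- **Fibre sums of a character that does NOT factor through `M` vanish**: if `ψ` is non-trivial
on the kernel of `(ℤ/m)ˣ → (ℤ/M)ˣ` then `∑_{u ≡ v (M)} ψ(u) = 0` for every `v`.
[cite: KubertLang1981, Ch. 1 §3] -/
theorem sum_fiber_eq_zero_of_not_factorsThrough [NeZero m] {M : ℕ} (hM : M ∣ m)
    {ψ : DirichletCharacter ℂ m} (hψ : ¬ ψ.FactorsThrough M) (v : ZMod M) :
    ∑ u : ZMod m, (if ZMod.castHom hM (ZMod M) u = v then ψ u else 0) = 0 := by
  classical
  rw [DirichletCharacter.factorsThrough_iff_ker_unitsMap hM] at hψ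
  obtain ⟨k, hk, hk1⟩ : ∃ k : (ZMod m)ˣ, ZMod.unitsMap hM k = 1 ∧ ψ k ≠ 1 := by
    by_contra hcon
    push Not at hcon
    exact hψ fun k hk ↦ by
      rw [MonoidHom.mem_ker] at hk ⊢
      ext
      rw [MulChar.coe_toUnitHom, Units.val_one]
      exact hcon k hk
  have hkcast : ZMod.castHom hM (ZMod M) (k : ZMod m) = 1 := by
    have := congrArg (fun z : (ZMod M)ˣ ↦ (z : ZMod M)) hk
    simpa [ZMod.unitsMap_def] using this
  set S := ∑ u : ZMod m, (if ZMod.castHom hM (ZMod M) u = v then ψ u else 0) with hS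
  have hmul : S = ψ k * S := by
    rw [hS, Finset.mul_sum]
    conv_lhs => rw [← Equiv.sum_comp k.mulLeft]
    refine Finset.sum_congr rfl fun u _ ↦ ?_
    simp only [Units.mulLeft_apply, map_mul, hkcast, one_mul, mul_ite, mul_zero]
  have : (ψ k - 1) * S = 0 := by rw [sub_mul, one_mul, ← hmul, sub_self]
  exact (mul_eq_zero.mp this).resolve_left (sub_ne_zero.mpr hk1)

/-! ### Aoki's Proposition 2.1 (Kubert–Lang ST1–ST4): the twisted Bernoulli sums at a point of level `M` -/

/-- **[Aoki1983, Prop. 2.1] / Kubert–Lang ST1–ST4, factoring case.** For `M ∣ m`, a unit `w` of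
`ℤ/M` and a character `ψ = ψ₀ ∘ (mod M)` of `ℤ/m` factoring through `M`:
`∑_u ψ(u) β_m(u · (m/M)w) = (φ(m)/φ(M)) ψ₀(w)⁻¹ B₁(ψ₀)` with `B₁(ψ₀) = ∑_{s mod M} ψ₀(s) β_M(s)`.
[cite: Aoki1983, Prop. 2.1] [cite: KubertLang1981, Ch. 1 §3 ST1–ST4] -/
theorem sum_char_mul_bern_lift_of_changeLevel [NeZero m] {M : ℕ} [NeZero M] (hM : M ∣ m)
    (ψ₀ : DirichletCharacter ℂ M) {w : ZMod M} (hw : IsUnit w) :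
    ∑ u : ZMod m, DirichletCharacter.changeLevel hM ψ₀ u *
      (if (u * (((m / M : ℕ) : ZMod m) * ((ZMod.val w : ℕ) : ZMod m))) = (0 : ZMod m) then (0 : ℂ)
        else (((ZMod.val (u * (((m / M : ℕ) : ZMod m) * ((ZMod.val w : ℕ) : ZMod m))) : ℕ) : ℂ) /
          (m : ℂ) - 1 / 2)) =
      ((m.totient : ℂ) / (M.totient : ℂ)) * (ψ₀ w)⁻¹ *
        ∑ s : ZMod M, ψ₀ s * (if s = (0 : ZMod M) then (0 : ℂ) else
          (((ZMod.val s : ℕ) : ℂ) / (M : ℂ) - 1 / 2)) := by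
  classical
  -- Step 1: the argument `u · (m/M)w` is the lift of `ūw`, where `β_m` takes the value `β_M(ūw)`
  have h1 : ∀ u : ZMod m,
      (if (u * (((m / M : ℕ) : ZMod m) * ((ZMod.val w : ℕ) : ZMod m))) = (0 : ZMod m) then (0 : ℂ)
        else (((ZMod.val (u * (((m / M : ℕ) : ZMod m) * ((ZMod.val w : ℕ) : ZMod m))) : ℕ) : ℂ) /
          (m : ℂ) - 1 / 2)) =
      (if (ZMod.castHom hM (ZMod M) u * w) = (0 : ZMod M) then (0 : ℂ) else
        (((ZMod.val (ZMod.castHom hM (ZMod M) u * w) : ℕ) : ℂ) / (M : ℂ) - 1 / 2)) := by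
    intro u
    rw [mul_lift_eq hM u w, bern_lift hM]
  simp_rw [h1]
  -- Step 2: sum fibrewise over `ū = v`
  rw [← Finset.sum_fiberwise univ (ZMod.castHom hM (ZMod M)) (fun u ↦
    DirichletCharacter.changeLevel hM ψ₀ u *
      (if (ZMod.castHom hM (ZMod M) u * w) = (0 : ZMod M) then (0 : ℂ) else
        (((ZMod.val (ZMod.castHom hM (ZMod M) u * w) : ℕ) : ℂ) / (M : ℂ) - 1 / 2)))]
  have h2 : ∀ v : ZMod M,
      ∑ u ∈ univ.filter (fun u ↦ ZMod.castHom hM (ZMod M) u = v),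
        DirichletCharacter.changeLevel hM ψ₀ u *
          (if (ZMod.castHom hM (ZMod M) u * w) = (0 : ZMod M) then (0 : ℂ) else
            (((ZMod.val (ZMod.castHom hM (ZMod M) u * w) : ℕ) : ℂ) / (M : ℂ) - 1 / 2)) =
      (∑ u : ZMod m, if ZMod.castHom hM (ZMod M) u = v then
          DirichletCharacter.changeLevel hM ψ₀ u else 0) *
        (if (v * w) = (0 : ZMod M) then (0 : ℂ) else
          (((ZMod.val (v * w) : ℕ) : ℂ) / (M : ℂ) - 1 / 2)) := by
    intro v
    rw [Finset.sum_mul, Finset.sum_filter]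
    refine Finset.sum_congr rfl fun u _ ↦ ?_
    by_cases huv : ZMod.castHom hM (ZMod M) u = v
    · rw [if_pos huv, huv, if_pos rfl]
    · rw [if_neg huv, if_neg huv, zero_mul]
  simp_rw [h2, sum_fiber_changeLevel hM ψ₀]
  -- Step 3: reindex by the unit `w`
  have h3 : ∑ s : ZMod M, ψ₀ s * (if s = (0 : ZMod M) then (0 : ℂ) else
        (((ZMod.val s : ℕ) : ℂ) / (M : ℂ) - 1 / 2)) =
      ψ₀ w * ∑ v : ZMod M, ψ₀ v * (if (v * w) = (0 : ZMod M) then (0 : ℂ) else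
        (((ZMod.val (v * w) : ℕ) : ℂ) / (M : ℂ) - 1 / 2)) := by
    rw [← Equiv.sum_comp hw.unit.mulRight, Finset.mul_sum]
    refine sum_congr rfl fun v _ ↦ ?_
    simp only [Units.mulRight_apply, IsUnit.unit_spec, map_mul]
    ring
  have hw0 : ψ₀ w ≠ 0 := (hw.map ψ₀).ne_zero
  rw [h3, mul_assoc (((m.totient : ℂ) / (M.totient : ℂ))) ((ψ₀ w)⁻¹), inv_mul_cancel_left₀ hw0,
    Finset.mul_sum]
  refine sum_congr rfl fun v _ ↦ ?_
  ring

/-- **[Aoki1983, Prop. 2.1], non-factoring case.** If `ψ` does not factor through `M`, then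
`∑_u ψ(u) β_m(u · (m/M)w) = 0` for every `w ∈ ℤ/M`. [cite: Aoki1983, Prop. 2.1] [cite: KubertLang1981, Ch. 1 §3 ST1–ST4] -/
theorem sum_char_mul_bern_lift_of_not_factorsThrough [NeZero m] {M : ℕ} (hM : M ∣ m)
    {ψ : DirichletCharacter ℂ m} (hψ : ¬ ψ.FactorsThrough M) (w : ZMod M) :
    ∑ u : ZMod m, ψ u *
      (if (u * (((m / M : ℕ) : ZMod m) * ((ZMod.val w : ℕ) : ZMod m))) = (0 : ZMod m) then (0 : ℂ)
        else (((ZMod.val (u * (((m / M : ℕ) : ZMod m) * ((ZMod.val w : ℕ) : ZMod m))) : ℕ) : ℂ) /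
          (m : ℂ) - 1 / 2)) = 0 := by
  classical
  obtain ⟨hM0, -, -⟩ := KoblitzOgus.div_ne_zero_of_dvd hM
  haveI : NeZero M := ⟨hM0⟩
  have h1 : ∀ u : ZMod m,
      (if (u * (((m / M : ℕ) : ZMod m) * ((ZMod.val w : ℕ) : ZMod m))) = (0 : ZMod m) then (0 : ℂ)
        else (((ZMod.val (u * (((m / M : ℕ) : ZMod m) * ((ZMod.val w : ℕ) : ZMod m))) : ℕ) : ℂ) /
          (m : ℂ) - 1 / 2)) =
      (if (ZMod.castHom hM (ZMod M) u * w) = (0 : ZMod M) then (0 : ℂ) else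
        (((ZMod.val (ZMod.castHom hM (ZMod M) u * w) : ℕ) : ℂ) / (M : ℂ) - 1 / 2)) := by
    intro u
    rw [mul_lift_eq hM u w, bern_lift hM]
  simp_rw [h1]
  rw [← Finset.sum_fiberwise univ (ZMod.castHom hM (ZMod M)) (fun u ↦ ψ u *
      (if (ZMod.castHom hM (ZMod M) u * w) = (0 : ZMod M) then (0 : ℂ) else
        (((ZMod.val (ZMod.castHom hM (ZMod M) u * w) : ℕ) : ℂ) / (M : ℂ) - 1 / 2)))]
  refine Finset.sum_eq_zero fun v _ ↦ ?_
  have h2 : ∑ u ∈ univ.filter (fun u ↦ ZMod.castHom hM (ZMod M) u = v), ψ u *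
        (if (ZMod.castHom hM (ZMod M) u * w) = (0 : ZMod M) then (0 : ℂ) else
          (((ZMod.val (ZMod.castHom hM (ZMod M) u * w) : ℕ) : ℂ) / (M : ℂ) - 1 / 2)) =
      (∑ u : ZMod m, if ZMod.castHom hM (ZMod M) u = v then ψ u else 0) *
        (if (v * w) = (0 : ZMod M) then (0 : ℂ) else
          (((ZMod.val (v * w) : ℕ) : ℂ) / (M : ℂ) - 1 / 2)) := by
    rw [Finset.sum_mul, Finset.sum_filter]
    refine Finset.sum_congr rfl fun u _ ↦ ?_
    by_cases huv : ZMod.castHom hM (ZMod M) u = v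
    · rw [if_pos huv, huv, if_pos rfl]
    · rw [if_neg huv, if_neg huv, zero_mul]
  rw [h2, sum_fiber_eq_zero_of_not_factorsThrough hM hψ v, zero_mul]


/-! ### Euler factors: the Bernoulli sum of an induced character ([Aoki1983, §2]; [Lang1990, Ch. 2 §2]) -/

/-- **Level lowering**: for `f ∣ N` and `χ` mod `f`, `∑_{x mod N} χ(x mod f) β_N(x) = B₁(χ)`, where
`B₁(χ) = ∑_{v mod f} χ(v) β_f(v)` (the distribution relation of `β`). [cite: Lang1990, Ch. 2 §2] -/
theorem sum_char_cast_mul_bern {N f : ℕ} [NeZero N] [NeZero f] (hf : f ∣ N)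
    (χ : DirichletCharacter ℂ f) :
    ∑ x : ZMod N, χ (ZMod.castHom hf (ZMod f) x) *
        (if x = (0 : ZMod N) then (0 : ℂ) else (((ZMod.val x : ℕ) : ℂ) / (N : ℂ) - 1 / 2)) =
      ∑ v : ZMod f, χ v * (if v = (0 : ZMod f) then (0 : ℂ) else
        (((ZMod.val v : ℕ) : ℂ) / (f : ℂ) - 1 / 2)) := by
  rw [KoblitzOgus.sum_eq_sum_level hf
    (fun x : ZMod N ↦ (if x = (0 : ZMod N) then (0 : ℂ) else (((ZMod.val x : ℕ) : ℂ) / (N : ℂ) - 1 / 2)))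
    (fun y ↦ KoblitzOgus.bern_dist hf y) χ]
  refine sum_congr rfl fun v _ ↦ ?_
  rw [bern_lift hf v]

/-- `((d·k : ℕ) : ℤ/M).val = d·k` for `k ∈ ℤ/(M/d)`. [folklore] -/
theorem val_cast_mul {M d : ℕ} [NeZero M] (hd : d ∣ M) (k : ZMod (M / d)) :
    ((d * k.val : ℕ) : ZMod M).val = d * k.val := by
  obtain ⟨hd0, hq0, hMd⟩ := KoblitzOgus.div_ne_zero_of_dvd hd
  haveI : NeZero (M / d) := ⟨hq0⟩
  refine ZMod.val_natCast_of_lt ?_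
  calc d * k.val < d * (M / d) :=
        Nat.mul_lt_mul_of_pos_left (ZMod.val_lt k) (Nat.pos_of_ne_zero hd0)
    _ = M := hMd.symm

/-- **The multiples of `d` in `ℤ/M`** are the `d·k`, `k ∈ ℤ/(M/d)`: reindexing a sum. [folklore] -/
theorem sum_filter_dvd_eq {M d : ℕ} [NeZero M] [NeZero (M / d)] (hd : d ∣ M) (F : ZMod M → ℂ) :
    ∑ s ∈ univ.filter (fun s : ZMod M ↦ d ∣ s.val), F s =
      ∑ k : ZMod (M / d), F ((d * k.val : ℕ) : ZMod M) := by
  classical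
  obtain ⟨hd0, hq0, hMd⟩ := KoblitzOgus.div_ne_zero_of_dvd hd
  have hinj : Function.Injective (fun k : ZMod (M / d) ↦ ((d * k.val : ℕ) : ZMod M)) := by
    intro k₁ k₂ h
    have h' := congrArg ZMod.val h
    simp only [val_cast_mul hd] at h'
    exact ZMod.val_injective _ (Nat.eq_of_mul_eq_mul_left (Nat.pos_of_ne_zero hd0) h')
  rw [← Finset.sum_image (fun k₁ _ k₂ _ h ↦ hinj h)]
  apply Finset.sum_congr _ (fun _ _ ↦ rfl)
  ext s
  simp only [mem_filter, mem_univ, true_and, mem_image]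
  constructor
  · rintro ⟨c, hc⟩
    refine ⟨(c : ZMod (M / d)), ?_⟩
    have hc' : c < M / d := by
      have hlt : d * c < d * (M / d) := by rw [← hc, ← hMd]; exact ZMod.val_lt s
      exact Nat.lt_of_mul_lt_mul_left hlt
    change ((d * (c : ZMod (M / d)).val : ℕ) : ZMod M) = s
    rw [ZMod.val_natCast_of_lt hc', ← hc, ZMod.natCast_zmod_val]
  · rintro ⟨k, rfl⟩
    exact ⟨k.val, val_cast_mul hd k⟩

/-- `β_M(d·k) = β_{M/d}(k)`. [folklore] -/
theorem bern_cast_mul {M d : ℕ} [NeZero M] [NeZero (M / d)] (hd : d ∣ M) (k : ZMod (M / d)) :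
    (if (((d * k.val : ℕ) : ZMod M)) = (0 : ZMod M) then (0 : ℂ)
      else (((ZMod.val (((d * k.val : ℕ) : ZMod M)) : ℕ) : ℂ) / (M : ℂ) - 1 / 2)) =
    (if k = (0 : ZMod (M / d)) then (0 : ℂ) else
      (((ZMod.val k : ℕ) : ℂ) / ((M / d : ℕ) : ℂ) - 1 / 2)) := by
  obtain ⟨hd0, hq0, hMd⟩ := KoblitzOgus.div_ne_zero_of_dvd hd
  have hval := val_cast_mul hd k
  by_cases hk : k = 0
  · have h0 : ((d * k.val : ℕ) : ZMod M) = 0 := by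
      rw [hk, ZMod.val_zero, mul_zero, Nat.cast_zero]
    rw [if_pos h0, if_pos hk]
  · have hne : ((d * k.val : ℕ) : ZMod M) ≠ 0 := by
      rw [Ne, ← ZMod.val_eq_zero, hval]
      exact Nat.mul_ne_zero hd0 ((ZMod.val_ne_zero k).mpr hk)
    rw [if_neg hne, if_neg hk, hval]
    have hM : (M : ℂ) = d * (M / d : ℕ) := by exact_mod_cast hMd
    rw [hM]
    have hdC : (d : ℂ) ≠ 0 := by exact_mod_cast hd0
    have hqC : ((M / d : ℕ) : ℂ) ≠ 0 := by exact_mod_cast hq0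
    push_cast
    field_simp

/-- For `d ∣ M` with `f ∣ M/d`: `∑_{s mod M, d ∣ s} χ(s mod f) β_M(s) = χ(d) B₁(χ)` (substitute
`s = d k` and lower the level from `M/d` to `f`). [cite: Lang1990, Ch. 2 §2] -/
theorem sum_filter_dvd_char_mul_bern {M f d : ℕ} [NeZero M] [NeZero f] [NeZero (M / d)]
    (hd : d ∣ M) (hf : f ∣ M / d) (χ : DirichletCharacter ℂ f) :
    ∑ s ∈ univ.filter (fun s : ZMod M ↦ d ∣ s.val), χ ((s.val : ℕ) : ZMod f) *
        (if s = (0 : ZMod M) then (0 : ℂ) else (((ZMod.val s : ℕ) : ℂ) / (M : ℂ) - 1 / 2)) =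
      χ (d : ZMod f) * ∑ v : ZMod f, χ v * (if v = (0 : ZMod f) then (0 : ℂ) else
        (((ZMod.val v : ℕ) : ℂ) / (f : ℂ) - 1 / 2)) := by
  classical
  rw [sum_filter_dvd_eq hd]
  have hterm : ∀ k : ZMod (M / d),
      χ (((((d * k.val : ℕ) : ZMod M)).val : ℕ) : ZMod f) *
        (if (((d * k.val : ℕ) : ZMod M)) = (0 : ZMod M) then (0 : ℂ)
          else (((ZMod.val (((d * k.val : ℕ) : ZMod M)) : ℕ) : ℂ) / (M : ℂ) - 1 / 2)) =
      χ (d : ZMod f) * (χ (ZMod.castHom hf (ZMod f) k) *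
        (if k = (0 : ZMod (M / d)) then (0 : ℂ) else
          (((ZMod.val k : ℕ) : ℂ) / ((M / d : ℕ) : ℂ) - 1 / 2))) := by
    intro k
    rw [bern_cast_mul hd k, val_cast_mul hd k, Nat.cast_mul, map_mul, ZMod.castHom_apply,
      ZMod.cast_eq_val, mul_assoc]
  rw [Finset.sum_congr rfl (fun k _ ↦ hterm k), ← Finset.mul_sum, sum_char_cast_mul_bern hf χ]

/-- Inclusion–exclusion over a set `T` of primes of `M` not dividing `f` (induction on `T`):
`∑_{s mod M : d ∣ s, q ∤ s (q ∈ T)} χ(s mod f) β_M(s) = χ(d) ∏_{q ∈ T} (1 - χ(q)) · B₁(χ)`.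
[cite: Lang1990, Ch. 2 §2] -/
theorem sum_filter_coprime_char_mul_bern {M f : ℕ} [NeZero M] [NeZero f] (hfM : f ∣ M)
    (χ : DirichletCharacter ℂ f) (T : Finset ℕ) (hT : ∀ q ∈ T, q.Prime ∧ q ∣ M ∧ ¬ q ∣ f) :
    ∀ d : ℕ, d * (∏ q ∈ T, q) ∣ M → Nat.Coprime d (∏ q ∈ T, q) → Nat.Coprime d f →
      ∑ s ∈ univ.filter (fun s : ZMod M ↦ (∀ q ∈ T, ¬ q ∣ s.val) ∧ d ∣ s.val),
          χ ((s.val : ℕ) : ZMod f) *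
            (if s = (0 : ZMod M) then (0 : ℂ) else (((ZMod.val s : ℕ) : ℂ) / (M : ℂ) - 1 / 2)) =
        χ (d : ZMod f) * (∏ q ∈ T, (1 - χ q)) * ∑ v : ZMod f, χ v *
          (if v = (0 : ZMod f) then (0 : ℂ) else (((ZMod.val v : ℕ) : ℂ) / (f : ℂ) - 1 / 2)) := by
  classical
  induction T using Finset.induction_on with
  | empty =>
    intro d hdM _ hdf
    rw [Finset.prod_empty, mul_one] at hdM
    obtain ⟨hd0, hq0, hMd⟩ := KoblitzOgus.div_ne_zero_of_dvd hdM
    haveI : NeZero (M / d) := ⟨hq0⟩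
    have hf' : f ∣ M / d := by
      refine hdf.symm.dvd_of_dvd_mul_left ?_
      rw [← hMd]
      exact hfM
    have hfilt : (univ.filter fun s : ZMod M ↦ (∀ q ∈ (∅ : Finset ℕ), ¬ q ∣ s.val) ∧ d ∣ s.val) =
        univ.filter fun s : ZMod M ↦ d ∣ s.val := by
      ext s
      simp
    rw [hfilt, Finset.prod_empty, mul_one, sum_filter_dvd_char_mul_bern hdM hf' χ]
  | insert p T hp ih =>
    intro d hdM hcop hdf
    have hpT : ∀ q ∈ T, q.Prime ∧ q ∣ M ∧ ¬ q ∣ f := fun q hq ↦ hT q (Finset.mem_insert_of_mem hq)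
    obtain ⟨hpp, hpM, hpf⟩ := hT p (Finset.mem_insert_self p T)
    rw [Finset.prod_insert hp] at hdM hcop
    -- the two instances of the induction hypothesis
    have hdp : Nat.Coprime d p := hcop.coprime_mul_right_right
    have hdT : Nat.Coprime d (∏ q ∈ T, q) := hcop.coprime_mul_left_right
    have hpT' : Nat.Coprime p (∏ q ∈ T, q) := by
      refine Nat.coprime_prod_right_iff.mpr fun q hq ↦ (Nat.coprime_primes hpp (hpT q hq).1).mpr ?_
      rintro rfl
      exact hp hq
    have h1 := ih hpT d ((Dvd.intro p (by ring) : d * ∏ q ∈ T, q ∣ d * (p * ∏ q ∈ T, q)).trans hdM)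
      hdT hdf
    have h2 := ih hpT (d * p) (by rw [mul_assoc]; exact hdM) (hdT.mul_left hpT')
      (hdf.mul_left ((Nat.Prime.coprime_iff_not_dvd hpp).mpr hpf))
    -- split the sum over `¬ p ∣ s`
    have hsplit := Finset.sum_filter_add_sum_filter_not
      (univ.filter fun s : ZMod M ↦ (∀ q ∈ T, ¬ q ∣ s.val) ∧ d ∣ s.val) (fun s : ZMod M ↦ p ∣ s.val)
      (fun s : ZMod M ↦ χ ((s.val : ℕ) : ZMod f) *
        (if s = (0 : ZMod M) then (0 : ℂ) else (((ZMod.val s : ℕ) : ℂ) / (M : ℂ) - 1 / 2)))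
    rw [Finset.filter_filter, Finset.filter_filter] at hsplit
    have hA : (univ.filter fun s : ZMod M ↦ ((∀ q ∈ T, ¬ q ∣ s.val) ∧ d ∣ s.val) ∧ p ∣ s.val) =
        univ.filter fun s : ZMod M ↦ (∀ q ∈ T, ¬ q ∣ s.val) ∧ d * p ∣ s.val := by
      ext s
      simp only [mem_filter, mem_univ, true_and]
      constructor
      · rintro ⟨⟨hq, hd⟩, hps⟩
        exact ⟨hq, hdp.mul_dvd_of_dvd_of_dvd hd hps⟩
      · rintro ⟨hq, hdps⟩
        exact ⟨⟨hq, (Dvd.intro _ rfl).trans hdps⟩, (Dvd.intro_left _ rfl).trans hdps⟩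
    have hB : (univ.filter fun s : ZMod M ↦ ((∀ q ∈ T, ¬ q ∣ s.val) ∧ d ∣ s.val) ∧ ¬ p ∣ s.val) =
        univ.filter fun s : ZMod M ↦ (∀ q ∈ insert p T, ¬ q ∣ s.val) ∧ d ∣ s.val := by
      ext s
      simp only [mem_filter, mem_univ, true_and, Finset.forall_mem_insert]
      tauto
    rw [hA, hB, h1, h2] at hsplit
    rw [eq_sub_of_add_eq' hsplit, Finset.prod_insert hp, Nat.cast_mul, map_mul]
    ring

/-- **Euler factors of the first Bernoulli number** (the factor `∏ (1 - p⁻¹)` of Aoki's `τ_d`): for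
`χ` mod `f` and `f ∣ M`, the Bernoulli sum of the induced character `χ ∘ (mod M)` is
`B₁(χ ∘ (mod M)) = ∏_{p ∣ M} (1 - χ(p)) · B₁(χ)` (primes dividing `f` contribute `χ(p) = 0`).
[cite: Aoki1983, §2 (definition of τ_d) and Prop. 2.1] [cite: Lang1990, Ch. 2 §2] -/
theorem bernoulliSum_changeLevel {M f : ℕ} [NeZero M] [NeZero f] (hf : f ∣ M)
    (χ : DirichletCharacter ℂ f) :
    ∑ s : ZMod M, DirichletCharacter.changeLevel hf χ s *
        (if s = (0 : ZMod M) then (0 : ℂ) else (((ZMod.val s : ℕ) : ℂ) / (M : ℂ) - 1 / 2)) =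
      (∏ p ∈ M.primeFactors, (1 - χ p)) * ∑ v : ZMod f, χ v *
        (if v = (0 : ZMod f) then (0 : ℂ) else (((ZMod.val v : ℕ) : ℂ) / (f : ℂ) - 1 / 2)) := by
  classical
  set P' := M.primeFactors.filter (fun p ↦ ¬ p ∣ f) with hP'
  have hT : ∀ q ∈ P', q.Prime ∧ q ∣ M ∧ ¬ q ∣ f := by
    intro q hq
    rw [hP', Finset.mem_filter, Nat.mem_primeFactors] at hq
    exact ⟨hq.1.1, hq.1.2.1, hq.2⟩
  -- pointwise: `(χ ∘ mod M)(s) = [q ∤ s for q ∈ P'] χ(s mod f)`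
  have hpt : ∀ s : ZMod M, DirichletCharacter.changeLevel hf χ s =
      if (∀ q ∈ P', ¬ q ∣ s.val) ∧ 1 ∣ s.val then χ ((s.val : ℕ) : ZMod f) else 0 := by
    intro s
    rw [changeLevel_apply_eq hf χ s, ZMod.castHom_apply, ZMod.cast_eq_val]
    by_cases hu : IsUnit ((s.val : ℕ) : ZMod f)
    · have hcf : Nat.Coprime s.val f := (ZMod.isUnit_iff_coprime _ _).mp hu
      have h1 : IsUnit s ↔ Nat.Coprime s.val M := by
        conv_lhs => rw [← ZMod.natCast_zmod_val s]
        exact ZMod.isUnit_iff_coprime s.val M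
      have hiff : IsUnit s ↔ (∀ q ∈ P', ¬ q ∣ s.val) := by
        rw [h1]
        constructor
        · intro hc q hq hqs
          have := Nat.eq_one_of_dvd_coprimes hc hqs (hT q hq).2.1
          exact (hT q hq).1.one_lt.ne' this
        · intro hall
          refine Nat.coprime_of_dvd fun k hk hks hkM ↦ ?_
          by_cases hkf : k ∣ f
          · exact hk.one_lt.ne' (Nat.eq_one_of_dvd_coprimes hcf hks hkf)
          · exact hall k (by
              rw [hP', Finset.mem_filter, Nat.mem_primeFactors]
              exact ⟨⟨hk, hkM, NeZero.ne M⟩, hkf⟩) hks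
      by_cases hs : IsUnit s
      · rw [if_pos hs, if_pos ⟨hiff.mp hs, one_dvd _⟩]
      · rw [if_neg hs, if_neg (fun h ↦ hs (hiff.mpr h.1))]
    · rw [MulChar.map_nonunit χ hu, ite_self, ite_self]
  have hdiv : 1 * ∏ q ∈ P', q ∣ M := by
    rw [one_mul]
    exact (Finset.prod_dvd_prod_of_subset _ _ _ (Finset.filter_subset _ _)).trans
      (Nat.prod_primeFactors_dvd M)
  have haux := sum_filter_coprime_char_mul_bern hf χ P' hT 1 hdiv (Nat.coprime_one_left _)
    (Nat.coprime_one_left _)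
  rw [Finset.sum_filter, Nat.cast_one, map_one, one_mul] at haux
  have hprod : ∏ p ∈ M.primeFactors, (1 - χ p) = ∏ p ∈ P', (1 - χ p) := by
    rw [hP', Finset.prod_filter]
    refine prod_congr rfl fun p hp ↦ ?_
    by_cases hpf : p ∣ f
    · have hnu : ¬ IsUnit (p : ZMod f) := by
        rw [ZMod.isUnit_prime_iff_not_dvd (Nat.prime_of_mem_primeFactors hp)]
        exact not_not.mpr hpf
      rw [if_neg (not_not.mpr hpf), MulChar.map_nonunit χ hnu, sub_zero]
    · rw [if_pos hpf]
  rw [hprod, ← haux]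
  refine sum_congr rfl fun s _ ↦ ?_
  rw [hpt s]
  split_ifs <;> simp

/-- **`B₁(χ) ≠ 0` for an odd primitive character** ([Aoki1983, Lemma 2.3], cf. Borevich–Shafarevich):
`∑_{v mod f} χ(v) β_f(v) = (1/f) ∑ χ(v) v ≠ 0`, the tree's `KoblitzOgus.sum_char_mul_val_ne_zero`
(`L(0, χ) = -B_{1,χ} ≠ 0`). [cite: Aoki1983, Lemma 2.3] -/
theorem bernoulliSum_ne_zero {f : ℕ} [NeZero f] {χ : DirichletCharacter ℂ f} (hχ : χ.Odd)
    (hprim : χ.IsPrimitive) :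
    ∑ v : ZMod f, χ v * (if v = (0 : ZMod f) then (0 : ℂ) else
      (((ZMod.val v : ℕ) : ℂ) / (f : ℂ) - 1 / 2)) ≠ 0 := by
  have hf1 : f ≠ 1 := KoblitzOgus.level_ne_one_of_odd hχ
  have hsum : ∑ v : ZMod f, χ v = 0 := χ.sum_eq_zero_of_ne_one (KoblitzOgus.ne_one_of_odd hχ)
  have hpt : ∀ v : ZMod f, χ v * (if v = (0 : ZMod f) then (0 : ℂ) else
      (((ZMod.val v : ℕ) : ℂ) / (f : ℂ) - 1 / 2)) =
      (1 / f) * (χ v * (v.val : ℂ)) - (1 / 2) * χ v := by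
    intro v
    by_cases hv0 : v = 0
    · rw [hv0, χ.map_zero' hf1]; simp
    · rw [if_neg hv0]; ring
  rw [sum_congr rfl fun v _ ↦ hpt v, sum_sub_distrib, ← mul_sum, ← mul_sum, hsum, mul_zero,
    sub_zero]
  exact mul_ne_zero (one_div_ne_zero (by exact_mod_cast NeZero.ne f))
    (KoblitzOgus.sum_char_mul_val_ne_zero hχ hprim)


/-! ### Aoki's criterion: the necessary condition at each conductor `f ∣ m` -/

/-- A character induced from a PRIMITIVE character of conductor `f` factors through `M` only if
`f ∣ M`. [folklore] -/
theorem dvd_of_factorsThrough_changeLevel [NeZero m] {f M : ℕ} (hfm : f ∣ m)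
    {χ : DirichletCharacter ℂ f} (hprim : χ.IsPrimitive)
    (h : (DirichletCharacter.changeLevel hfm χ).FactorsThrough M) : f ∣ M := by
  have h1 := DirichletCharacter.conductor_dvd_of_mem_conductorSet _
    ((DirichletCharacter.mem_conductorSet_iff _).mpr h)
  rw [DirichletCharacter.conductor_changeLevel χ hfm] at h1
  rwa [(DirichletCharacter.isPrimitive_def _).mp hprim] at h1

/-- Every `x ∈ ℤ/m` is the lift `(m/M)·w` of a UNIT `w` of the level `M = m / gcd(m, ⟨x⟩) ∣ m`
(the order of `x`). [folklore] -/
theorem exists_unit_lift_eq [NeZero m] (x : ZMod m) :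
    (m / m.gcd x.val) ∣ m ∧ ∃ w : ZMod (m / m.gcd x.val), IsUnit w ∧
      ((m / (m / m.gcd x.val) : ℕ) : ZMod m) * ((ZMod.val w : ℕ) : ZMod m) = x := by
  obtain ⟨h1, ⟨w, hw, hwx⟩, -⟩ := KoblitzOgus.lift_reduce (dvd_refl m) x
  refine ⟨h1, w, hw, ?_⟩
  rw [hwx, KoblitzOgus.lift_self]

/-- **Aoki's criterion** (the necessary direction of [Aoki1983, Prop. 2.2], "`α ∈ Bₘ ⇒
τ_{m/f}(α) ∈ A(f)`", made explicit by Prop. 2.1). Let `α = (α₀, …, α_{r-1})` be a Hodge character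
of level `m`, written coordinatewise as `αᵢ = (m/Mᵢ)·wᵢ` with `Mᵢ ∣ m` and `wᵢ` a unit mod `Mᵢ`
(`Mᵢ` = the order of `αᵢ`). Then for every `f ∣ m` and every ODD PRIMITIVE character `χ` mod `f`:
`∑_{i : f ∣ Mᵢ} (φ(m)/φ(Mᵢ)) · ∏_{p ∣ Mᵢ} (1 - χ(p)) · χ(wᵢ mod f)⁻¹ = 0`.
(Sum the Hodge condition against `ψ = χ ∘ (mod m)`; the `i`-th term is `L_ψ(αᵢ)`, computed by
Prop. 2.1 and the Euler-factor formula, and the common factor `B₁(χ) ≠ 0` (Lemma 2.3) cancels.)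
[cite: Aoki1983, Prop. 2.2 with Prop. 2.1 and Lemma 2.3] -/
theorem IsHodge.aoki_criterion [NeZero m] {r : ℕ} {α : Fin r → ZMod m} (h : IsHodge α)
    {f : ℕ} [NeZero f] (hfm : f ∣ m) {χ : DirichletCharacter ℂ f} (hχ : χ.Odd)
    (hprim : χ.IsPrimitive) (M : Fin r → ℕ) [∀ i, NeZero (M i)] (hM : ∀ i, M i ∣ m)
    (w : (i : Fin r) → ZMod (M i)) (hw : ∀ i, IsUnit (w i))
    (hα : ∀ i, α i = ((m / M i : ℕ) : ZMod m) * ((ZMod.val (w i) : ℕ) : ZMod m)) :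
    ∑ i, (if f ∣ M i then ((m.totient : ℂ) / ((M i).totient : ℂ)) *
        (∏ p ∈ (M i).primeFactors, (1 - χ p)) * (χ (ZMod.cast (w i) : ZMod f))⁻¹ else 0) = 0 := by
  classical
  set B := ∑ v : ZMod f, χ v * (if v = (0 : ZMod f) then (0 : ℂ) else
      (((ZMod.val v : ℕ) : ℂ) / (f : ℂ) - 1 / 2)) with hB
  have hB0 : B ≠ 0 := bernoulliSum_ne_zero hχ hprim
  have key := h.sum_sum_char_mul_bern_eq_zero (DirichletCharacter.changeLevel hfm χ)
  have hterm : ∀ i, ∑ u : ZMod m, DirichletCharacter.changeLevel hfm χ u *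
      (if (u * α i) = (0 : ZMod m) then (0 : ℂ) else
        (((ZMod.val (u * α i) : ℕ) : ℂ) / (m : ℂ) - 1 / 2)) =
      (if f ∣ M i then ((m.totient : ℂ) / ((M i).totient : ℂ)) *
        (∏ p ∈ (M i).primeFactors, (1 - χ p)) * (χ (ZMod.cast (w i) : ZMod f))⁻¹ else 0) * B := by
    intro i
    rw [hα i]
    by_cases hfi : f ∣ M i
    · have hψ : DirichletCharacter.changeLevel hfm χ =
          DirichletCharacter.changeLevel (hM i) (DirichletCharacter.changeLevel hfi χ) :=
        DirichletCharacter.changeLevel_trans χ hfi (hM i)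
      rw [hψ, sum_char_mul_bern_lift_of_changeLevel (hM i) _ (hw i), bernoulliSum_changeLevel hfi χ,
        if_pos hfi]
      have hwχ : DirichletCharacter.changeLevel hfi χ (w i) = χ (ZMod.cast (w i) : ZMod f) := by
        rw [← (hw i).unit_spec, DirichletCharacter.changeLevel_eq_cast_of_dvd χ hfi (hw i).unit]
      rw [hwχ, hB]
      ring
    · have hnf : ¬ (DirichletCharacter.changeLevel hfm χ).FactorsThrough (M i) :=
        fun hf' ↦ hfi (dvd_of_factorsThrough_changeLevel hfm hprim hf')
      rw [sum_char_mul_bern_lift_of_not_factorsThrough (hM i) hnf (w i), if_neg hfi, zero_mul]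
  simp_rw [hterm] at key
  rw [← Finset.sum_mul] at key
  exact (mul_eq_zero.mp key).resolve_right hB0

end FermatCharacter

end Literature.AlgebraicGeometry.HodgeTheory
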